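import Mathlib.Algebra.CharP.Basic
import Mathlib.RingTheory.Ideal.Operations
import Mathlib.Tactic.LinearCombination
import Mathlib.Tactic.Ring
import HarnessLib

/-!
# Chart algebra of Hauser's kangaroo surface `x² + y⁷ + yz⁴` (characteristic 2): the cusp blow-up and the classical sequence

Support file (OURS; kill test K4.5 row (ii), cell `res-hironaka`, rung L, slot W4.5, door
`EquisingularLift`, crux stmt-ResolutionOfSingularities-15660) — kernel-checked polynomial identities
behind the two centre lists of the K4.5(ii) residual «Hauser surface» (report
`run/shared/lean/pub/res-hironaka/L/res-L0-k45/KILL-TEST-K4.5.md` §2, job j261597). AI review is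
weaker than expert review; this file is an instrument of the cell and makes no statement about any
manuscript.

In characteristic `2` Hauser's polynomial has the NORMAL FORM
`x² + y⁷ + yz⁴ = x² + y·(y³ + z²)²` (`hauser_eq_normalForm`), so the surface `W = V(f) ⊂ 𝔸³` is
singular exactly along the planar cusp `C = V(x, g)`, `g = y³ + z²`, and `f ∈ (x, g)²`. Everything
below is stated for the normal form `x² + y·g²` over an ARBITRARY commutative ring (the identities
are characteristic-free once the normal form is reached; in characteristic `2` they are the chart
computations of the job).

* List 1 (one centre, the cusp `C`, class Π «planar reduced l.c.i., lifted as `V(x, g̃ − π)`»):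
  `Bl_{(x,g)} 𝔸³` has the two charts `g = xT` (ambient `{g = xT} ⊂ 𝔸⁴`, exceptional divisor `x = 0`)
  and `x = gS` (ambient `𝔸³_{y,z,S}`, exceptional divisor `g = 0`). `chartT_total` / `chartS_total` give
  total transform `=` (exceptional factor)² `·` strict transform, with strict transforms
  `1 + yT²` (on `{g = xT}`) and `S² + y`. `chartT_jacobianMinor_cert` is the Nullstellensatz certificate
  `(1 + yT²)(1 − yT² + y²T⁴) − y³T³·T³ = 1`: the `(x,y)`-minor `T³` of the Jacobian of
  `(1 + yT², g − xT)` (value in characteristic 2) is a unit modulo the strict-transform equation, so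
  the strict transform is regular by the Jacobian criterion (`chartT_span_eq_top`); on the other
  chart `∂(S² + y)/∂y = 1`.
* List 2 (classical: closed points and regular curves only, classes P/F): point blow-up of the
  origin (`pointBlowup_chartY/X/Z`), blow-up of the strict transform `C′ = V(x₁, y + z₁²)` of the cusp
  in the `y`-chart written with `u = y + z₁²` (`cuspCurveBlowup_coords`, `cuspCurveBlowup_chartU/X`;
  over a general ring the substitution is `y = u − z₁²`), blow-up of the strict transform
  `M′ = V(x₂, u − z₁²)` of the line `M = E₀ ∩ {dx = 0}` (`lineBlowup_chartV/X`), the same line in the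
  `z`-chart (`lineBlowupZ_chartZ/X`) and the final `A₁` point (`a1PointBlowup_chartY/Z/X`). After these
  four centres every chart equation is a unit or has its singular locus on a copy of `C′` that the
  `C′`-blow-up removes (Gröbner certificates: job j261597, part D).

References for the surface: H. Hauser, *On the problem of resolution of singularities in positive
characteristic*, Bull. AMS 47 (2010) (the kangaroo phenomenon); H. Hauser – S. Perlega,
*Cycles of singularities appearing in the resolution problem in positive characteristic*,
J. Algebraic Geom. 28 (2019) §3. The identities themselves are elementary [folklore].
-/

-- single-problem summit: the doubled namespace component `ResolutionOfSingularities` is forced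
set_option linter.dupNamespace false

namespace Summit.ResolutionOfSingularities.ResolutionOfSingularities.Theorems.EquisingularLift.HauserCusp

variable {R : Type} [CommRing R]

/-! ## Normal form in characteristic 2 -/

/-- In characteristic `2`, Hauser's kangaroo polynomial is `x² + y·(y³+z²)²`; in particular it lies
in the square of the ideal `(x, y³ + z²)` of the planar cusp. [folklore] -/
theorem hauser_eq_normalForm [CharP R 2] (x y z : R) :
    x ^ 2 + y ^ 7 + y * z ^ 4 = x ^ 2 + y * (y ^ 3 + z ^ 2) ^ 2 := by
  have h2 : (2 : R) = 0 := by exact_mod_cast CharP.cast_eq_zero R 2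
  linear_combination (-(y ^ 4 * z ^ 2)) * h2

/-- The normal form is explicitly a member of `(x, g)²`: `x² + y g² = x·x + (y·g)·g`. [folklore] -/
theorem normalForm_mem_span_sq (x y g : R) :
    x ^ 2 + y * g ^ 2 ∈ Ideal.span ({x, g} : Set R) ^ 2 := by
  have hx : x ∈ Ideal.span ({x, g} : Set R) := Ideal.subset_span (by simp)
  have hg : g ∈ Ideal.span ({x, g} : Set R) := Ideal.subset_span (by simp)
  have h1 : x ^ 2 ∈ Ideal.span ({x, g} : Set R) ^ 2 := Ideal.pow_mem_pow hx 2
  have h2 : y * g ^ 2 ∈ Ideal.span ({x, g} : Set R) ^ 2 :=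
    Ideal.mul_mem_left _ y (Ideal.pow_mem_pow hg 2)
  exact Ideal.add_mem _ h1 h2

/-! ## List 1: the blow-up of the cusp `C = V(x, g)` -/

/-- Chart `g = xT` of `Bl_{(x,g)} 𝔸³`: the normal form equals `x²·(1 + yT²)` plus a multiple of the
chart relation `g − xT`; i.e. total transform `= x² ·` strict transform `1 + yT²` on `{g = xT}`.
[folklore] -/
theorem chartT_total (x y g T : R) :
    x ^ 2 + y * g ^ 2 = x ^ 2 * (1 + y * T ^ 2) + y * (g + x * T) * (g - x * T) := by
  ring

/-- Chart `g = xT`: Nullstellensatz certificate that the Jacobian minor `T³` (columns `x, y` of the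
Jacobian of `(1 + yT², g − xT)` in characteristic `2`) is a unit modulo the strict-transform equation
`1 + yT²`. [folklore] -/
theorem chartT_jacobianMinor_cert (y T : R) :
    (1 + y * T ^ 2) * (1 - y * T ^ 2 + y ^ 2 * T ^ 4) - y ^ 3 * T ^ 3 * T ^ 3 = 1 := by
  ring

/-- Chart `g = xT`: the strict-transform equation and the Jacobian minor `T³` generate the unit
ideal (Jacobian criterion ⇒ the strict transform `V(1 + yT², g − xT) ⊂ 𝔸⁴` is regular). [folklore] -/
theorem chartT_span_eq_top (y T : R) :
    Ideal.span ({1 + y * T ^ 2, T ^ 3} : Set R) = ⊤ := by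
  rw [Ideal.eq_top_iff_one, Ideal.mem_span_pair]
  exact ⟨1 - y * T ^ 2 + y ^ 2 * T ^ 4, -(y ^ 3 * T ^ 3), by ring⟩

/-- Chart `x = gS` of `Bl_{(x,g)} 𝔸³` (ambient `𝔸³_{y,z,S}`): total transform `= g² ·` strict transform
`S² + y` (whose `y`-derivative is `1`, so it is regular). [folklore] -/
theorem chartS_total (y g S : R) :
    (g * S) ^ 2 + y * g ^ 2 = g ^ 2 * (S ^ 2 + y) := by
  ring

/-- Chart `x = gS`: the strict-transform equation `S² + y` and `1 = ∂(S² + y)/∂y` generate the unit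
ideal, recorded in the same shape as `chartT_span_eq_top`. [folklore] -/
theorem chartS_span_eq_top (y S : R) :
    Ideal.span ({S ^ 2 + y, 1} : Set R) = ⊤ := by
  rw [Ideal.eq_top_iff_one]
  exact Ideal.subset_span (by simp)

/-! ## List 2: the classical sequence `P₀ → C′ → M′ → P₁`

All identities are for the normal form `x² + y (y³ + z²)²`; «total = (exceptional variable)² · strict». -/

/-- Point blow-up of the origin, `y`-chart (`x = x₁y`, `z = z₁y`): strict transform
`x₁² + y³ (y + z₁²)²`, singular along `C′ = V(x₁, y + z₁²)` and `M = V(x₁, y)`. [folklore] -/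
theorem pointBlowup_chartY (x₁ y z₁ : R) :
    (x₁ * y) ^ 2 + y * (y ^ 3 + (z₁ * y) ^ 2) ^ 2 = y ^ 2 * (x₁ ^ 2 + y ^ 3 * (y + z₁ ^ 2) ^ 2) := by
  ring

/-- Point blow-up of the origin, `x`-chart (`y = y₁x`, `z = z₁x`): strict transform
`1 + y₁ x³ (y₁³ x + z₁²)²` (regular). [folklore] -/
theorem pointBlowup_chartX (x y₁ z₁ : R) :
    x ^ 2 + (y₁ * x) * ((y₁ * x) ^ 3 + (z₁ * x) ^ 2) ^ 2 =
      x ^ 2 * (1 + y₁ * x ^ 3 * (y₁ ^ 3 * x + z₁ ^ 2) ^ 2) := by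
  ring

/-- Point blow-up of the origin, `z`-chart (`x = x₁z`, `y = y₁z`): strict transform
`x₁² + y₁ z³ (1 + y₁³ z)²`, singular along `M = V(x₁, z)` and the copy `V(x₁, 1 + y₁³z)` of `C′`.
[folklore] -/
theorem pointBlowup_chartZ (x₁ y₁ z : R) :
    (x₁ * z) ^ 2 + (y₁ * z) * ((y₁ * z) ^ 3 + z ^ 2) ^ 2 =
      z ^ 2 * (x₁ ^ 2 + y₁ * z ^ 3 * (1 + y₁ ^ 3 * z) ^ 2) := by
  ring

/-- The `y`-chart strict transform in the coordinates `(x₁, u, z₁)`, `y = u − z₁²` (in characteristic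
`2`: `u = y + z₁²`), in which `C′ = V(x₁, u)`: it reads `x₁² + (u − z₁²)³ u²`. [folklore] -/
theorem cuspCurveBlowup_coords (x₁ u z₁ : R) :
    x₁ ^ 2 + (u - z₁ ^ 2) ^ 3 * ((u - z₁ ^ 2) + z₁ ^ 2) ^ 2 = x₁ ^ 2 + (u - z₁ ^ 2) ^ 3 * u ^ 2 := by
  ring

/-- Blow-up of `C′ = V(x₁, u)`, chart `u = x₁u₂`: strict transform `1 + u₂² (x₁u₂ − z₁²)³` (regular).
[folklore] -/
theorem cuspCurveBlowup_chartU (x₁ u₂ z₁ : R) :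
    x₁ ^ 2 + (x₁ * u₂ - z₁ ^ 2) ^ 3 * (x₁ * u₂) ^ 2 =
      x₁ ^ 2 * (1 + u₂ ^ 2 * (x₁ * u₂ - z₁ ^ 2) ^ 3) := by
  ring

/-- Blow-up of `C′ = V(x₁, u)`, chart `x₁ = ux₂`: strict transform `x₂² + (u − z₁²)³`, a cusp cylinder
singular exactly along `M′ = V(x₂, u − z₁²)`. [folklore] -/
theorem cuspCurveBlowup_chartX (x₂ u z₁ : R) :
    (u * x₂) ^ 2 + (u - z₁ ^ 2) ^ 3 * u ^ 2 = u ^ 2 * (x₂ ^ 2 + (u - z₁ ^ 2) ^ 3) := by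
  ring

/-- Blow-up of `M′ = V(x₂, v)`, `v = u − z₁²` (equation `x₂² + v³`), chart `v = x₂v₂`: strict transform
`1 + x₂ v₂³` (regular). [folklore] -/
theorem lineBlowup_chartV (x₂ v₂ : R) :
    x₂ ^ 2 + (x₂ * v₂) ^ 3 = x₂ ^ 2 * (1 + x₂ * v₂ ^ 3) := by
  ring

/-- Blow-up of `M′ = V(x₂, v)`, chart `x₂ = vx₃`: strict transform `x₃² + v` (regular). [folklore] -/
theorem lineBlowup_chartX (x₃ v : R) :
    (v * x₃) ^ 2 + v ^ 3 = v ^ 2 * (x₃ ^ 2 + v) := by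
  ring

/-- `z`-chart lineage: blow-up of `M = V(x₁, z)` on `x₁² + y₁ z³ (1 + y₁³z)²`, chart `z = x₁z₂`:
strict transform `1 + y₁ x₁ z₂³ (1 + y₁³ x₁ z₂)²` (regular). [folklore] -/
theorem lineBlowupZ_chartZ (x₁ y₁ z₂ : R) :
    x₁ ^ 2 + y₁ * (x₁ * z₂) ^ 3 * (1 + y₁ ^ 3 * (x₁ * z₂)) ^ 2 =
      x₁ ^ 2 * (1 + y₁ * x₁ * z₂ ^ 3 * (1 + y₁ ^ 3 * x₁ * z₂) ^ 2) := by
  ring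

/-- `z`-chart lineage: blow-up of `M = V(x₁, z)`, chart `x₁ = zx₃`: strict transform
`x₃² + y₁ z (1 + y₁³ z)²`, whose singular locus is the `A₁` point `V(x₃, y₁, z)` together with the
(disjoint) copy `V(x₃, 1 + y₁³z)` of `C′`. [folklore] -/
theorem lineBlowupZ_chartX (x₃ y₁ z : R) :
    (z * x₃) ^ 2 + y₁ * z ^ 3 * (1 + y₁ ^ 3 * z) ^ 2 = z ^ 2 * (x₃ ^ 2 + y₁ * z * (1 + y₁ ^ 3 * z) ^ 2) := by
  ring

/-- Blow-up of the `A₁` point `V(x₃, y₁, z)`, `y₁`-chart (`x₃ = a y₁`, `z = c y₁`): strict transform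
`a² + c (1 + c y₁⁴)²` (singular only on the copy `V(a, 1 + c y₁⁴)` of `C′`, off the new exceptional
divisor `y₁ = 0`). [folklore] -/
theorem a1PointBlowup_chartY (a y₁ c : R) :
    (a * y₁) ^ 2 + y₁ * (c * y₁) * (1 + y₁ ^ 3 * (c * y₁)) ^ 2 =
      y₁ ^ 2 * (a ^ 2 + c * (1 + c * y₁ ^ 4) ^ 2) := by
  ring

/-- Blow-up of the `A₁` point, `z`-chart (`x₃ = a z`, `y₁ = b z`): strict transform `a² + b (1 + b³ z⁴)²`
(singular only on the copy `V(a, 1 + b³z⁴)` of `C′`, off `z = 0`). [folklore] -/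
theorem a1PointBlowup_chartZ (a b z : R) :
    (a * z) ^ 2 + (b * z) * z * (1 + (b * z) ^ 3 * z) ^ 2 = z ^ 2 * (a ^ 2 + b * (1 + b ^ 3 * z ^ 4) ^ 2) := by
  ring

/-- Blow-up of the `A₁` point, `x₃`-chart (`y₁ = b x₃`, `z = c x₃`): strict transform
`1 + b c (1 + b³ c x₃⁴)²` (regular). [folklore] -/
theorem a1PointBlowup_chartX (x₃ b c : R) :
    x₃ ^ 2 + (b * x₃) * (c * x₃) * (1 + (b * x₃) ^ 3 * (c * x₃)) ^ 2 =
      x₃ ^ 2 * (1 + b * c * (1 + b ^ 3 * c * x₃ ^ 4) ^ 2) := by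
  ring

end Summit.ResolutionOfSingularities.ResolutionOfSingularities.Theorems.EquisingularLift.HauserCusp
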